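import Literature.MathematicalPhysics.QuantumFieldTheory.WilsonFinTorusPartitionComplex
import Summits.QuantumFields.YangMills.Theorems.FreeEnergyWindowChannel.Negative.WitnessRigidity
import Literature.Barriers.QuantumFields.DiscreteSubgroupFreezing
import HarnessLib

/-!
# `ComplexCouplingChannel.FreeEnergyWindowChannel` — line Sketch (transport), stub `stub_growth`

Trivial GROWTH bound of the symmetric-torus Wilson partition function at complex coupling
(crux stmt-QuantumFields-18842): for every compact group `G` and unitary lattice representation
`r` there is one `a ≥ 0`, depending only on `(G, r)`, with

  `‖Z_P(z)‖ ≤ exp (a · P⁴ · ‖z‖)`  for all `z : ℂ`, `P : ℕ`,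

`Z_P(z) = wilsonFinTorusPartitionC r.ρ z P P P P`.  Proof: `‖Z(z)‖ ≤ Z(Re z)`
(`norm_wilsonFinTorusPartitionC_le`), and `Z(β) = ∫ e^{-β S} dμ ≤ e^{|β| S_max}` against the
product Haar probability measure, where the Wilson action satisfies `0 ≤ S ≤ P⁴ · 12 N`
(`P⁴` sites, `6` plaquette orientations `{q : Fin 4 × Fin 4 // q.1 < q.2}`, and
`0 ≤ N − Re tr ρ(g) ≤ 2N` for unitary `ρ(g)`: `Re tr U ≤ N` is the tree's
`re_trace_le_of_mem_unitaryGroup`, applied also to the unitary `−U`); finally `|Re z| ≤ ‖z‖`.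
We take `a = 12 N`.

Nothing here asserts a Theses statement; the file supports the crux item.
-/

set_option autoImplicit false

noncomputable section

open MeasureTheory
open Literature.MathematicalPhysics.QuantumFieldTheory

namespace Summit.QuantumFields.YangMills.Theorems.FreeEnergyWindowChannel

variable {G : Type*} [Group G] [TopologicalSpace G] [IsTopologicalGroup G] [CompactSpace G]
  [MeasurableSpace G] [BorelSpace G]

/-- `−Re tr U ≤ N` for a unitary `N × N` matrix (`−U` is unitary too). [folklore] -/
private theorem neg_re_trace_le_of_mem_unitaryGroup {N : ℕ} {U : Matrix (Fin N) (Fin N) ℂ}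
    (hU : U ∈ Matrix.unitaryGroup (Fin N) ℂ) : -U.trace.re ≤ N := by
  have hneg : -U ∈ Matrix.unitaryGroup (Fin N) ℂ := by
    rw [Matrix.mem_unitaryGroup_iff] at hU ⊢
    simpa [star_neg] using hU
  have h := Literature.Barriers.QuantumFields.re_trace_le_of_mem_unitaryGroup hneg
  simpa [Matrix.trace_neg] using h

/-- There are six plaquette orientations `μ < ν` in four dimensions. [folklore] -/
private theorem card_plaquetteOrientations : Fintype.card {q : Fin 4 × Fin 4 // q.1 < q.2} = 6 := by
  decide

omit [MeasurableSpace G] [BorelSpace G] [IsTopologicalGroup G] [CompactSpace G] in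
/-- One plaquette term is at most `2N`: `N − Re tr ρ(g) ≤ 2N` for unitary `ρ`. [folklore] -/
private theorem plaquetteTerm_le (r : LatticeRep G) (g : G) :
    (r.N : ℝ) - (r.ρ g).trace.re ≤ 2 * r.N := by
  have h := neg_re_trace_le_of_mem_unitaryGroup (r.mem_unitary g)
  linarith

omit [MeasurableSpace G] [BorelSpace G] [IsTopologicalGroup G] [CompactSpace G] in
/-- The Wilson action of the symmetric `Fin`-torus `P⁴` is at most `P⁴ · 12 N`. [folklore] -/
private theorem finTorusWilsonAction_le (r : LatticeRep G) (P : ℕ)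
    (U : FinTorusSite P P P P × Fin 4 → G) :
    finTorusWilsonAction r.ρ U ≤ (P : ℝ) ^ 4 * (12 * r.N) := by
  unfold finTorusWilsonAction
  have hinner : ∀ x : FinTorusSite P P P P,
      ∑ q : {q : Fin 4 × Fin 4 // q.1 < q.2},
          ((r.N : ℝ) - (r.ρ (finTorusPlaquette U x q.1.1 q.1.2)).trace.re) ≤ 12 * r.N := by
    intro x
    have h := Finset.sum_le_card_nsmul (Finset.univ : Finset {q : Fin 4 × Fin 4 // q.1 < q.2})
      (fun q => (r.N : ℝ) - (r.ρ (finTorusPlaquette U x q.1.1 q.1.2)).trace.re) (2 * r.N)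
      (fun q _ => plaquetteTerm_le r _)
    rw [Finset.card_univ, card_plaquetteOrientations, nsmul_eq_mul] at h
    refine h.trans (le_of_eq ?_)
    push_cast
    ring
  have h := Finset.sum_le_card_nsmul (Finset.univ : Finset (FinTorusSite P P P P)) _ _
    (fun x _ => hinner x)
  refine h.trans (le_of_eq ?_)
  simp only [nsmul_eq_mul, Finset.card_univ, Fintype.card_prod, Fintype.card_fin]
  push_cast
  ring

/-- The integral of a function bounded above by `c ≥ 0` against the product Haar probability
measure is at most `c` (also when the function is not integrable). [folklore] -/
private theorem integral_pi_haar_le {ι : Type*} [Fintype ι] (g : (ι → G) → ℝ) {c : ℝ} (hc : 0 ≤ c)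
    (hg : ∀ U, g U ≤ c) : ∫ U, g U ∂(Measure.pi fun _ : ι => haarProbability G) ≤ c := by
  by_cases hint : Integrable g (Measure.pi fun _ : ι => haarProbability G)
  · calc ∫ U, g U ∂(Measure.pi fun _ : ι => haarProbability G)
        ≤ ∫ _U, c ∂(Measure.pi fun _ : ι => haarProbability G) :=
          integral_mono hint (integrable_const c) hg
      _ = c := by simp
  · rw [integral_undef hint]; exact hc

/-- **`Z(β) ≤ exp (|β| · P⁴ · 12 N)`**: the real partition function of the symmetric torus is the
integral of `e^{-β S} ≤ e^{|β| P⁴ 12 N}` (`0 ≤ S ≤ P⁴ · 12 N`) against a probability measure.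
[folklore] -/
private theorem wilsonFinTorusPartition_le_exp (r : LatticeRep G) (β : ℝ) (P : ℕ) :
    wilsonFinTorusPartition r.ρ β P P P P ≤ Real.exp (|β| * ((P : ℝ) ^ 4 * (12 * r.N))) := by
  unfold wilsonFinTorusPartition
  refine integral_pi_haar_le _ (Real.exp_pos _).le fun U => Real.exp_le_exp.2 ?_
  have hS0 : 0 ≤ finTorusWilsonAction r.ρ U := Negative.finTorusWilsonAction_nonneg r U
  have hS1 := finTorusWilsonAction_le r P U
  change -β * finTorusWilsonAction r.ρ U ≤ _
  calc -β * finTorusWilsonAction r.ρ U ≤ |β| * finTorusWilsonAction r.ρ U :=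
        mul_le_mul_of_nonneg_right (neg_le_abs β) hS0
    _ ≤ |β| * ((P : ℝ) ^ 4 * (12 * r.N)) := mul_le_mul_of_nonneg_left hS1 (abs_nonneg β)

/-- **Trivial growth of the symmetric-torus partition function at complex coupling** (stub
`stub_growth` of line Sketch): for one `a ≥ 0` depending only on `(G, r)`,
`‖Z_P(z)‖ ≤ exp (a P⁴ ‖z‖)` for all `z : ℂ` and `P : ℕ` (`‖Z(z)‖ ≤ Z(Re z) ≤ e^{|Re z| P⁴ a}`,
`|Re z| ≤ ‖z‖`; `a = 12 N`). [folklore] -/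
theorem stub_growth :
    ∀ (G : Type) [Group G] [TopologicalSpace G] [IsTopologicalGroup G] [CompactSpace G] [MeasurableSpace G] [BorelSpace G] (r : Literature.MathematicalPhysics.QuantumFieldTheory.LatticeRep G),
    ∃ a : ℝ, 0 ≤ a ∧ ∀ (z : ℂ) (P : ℕ),
      ‖Literature.MathematicalPhysics.QuantumFieldTheory.wilsonFinTorusPartitionC r.ρ z P P P P‖ ≤
        Real.exp (a * (P : ℝ) ^ 4 * ‖z‖) := by
  intro G _ _ _ _ _ _ r
  refine ⟨12 * r.N, by positivity, fun z P => ?_⟩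
  refine (norm_wilsonFinTorusPartitionC_le r.ρ z P P P P).trans
    ((wilsonFinTorusPartition_le_exp r z.re P).trans (Real.exp_le_exp.2 ?_))
  have h1 : |z.re| ≤ ‖z‖ := Complex.abs_re_le_norm z
  have h2 : 0 ≤ (P : ℝ) ^ 4 * (12 * r.N) := by positivity
  calc |z.re| * ((P : ℝ) ^ 4 * (12 * r.N)) ≤ ‖z‖ * ((P : ℝ) ^ 4 * (12 * r.N)) :=
        mul_le_mul_of_nonneg_right h1 h2
    _ = 12 * r.N * (P : ℝ) ^ 4 * ‖z‖ := by ring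

end Summit.QuantumFields.YangMills.Theorems.FreeEnergyWindowChannel

end
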